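import Literature.MathematicalPhysics.QuantumLattice.StabilityLTQOEstimatesProofs
import Literature.MathematicalPhysics.QuantumLattice.StabilityLocalDecompositionProofs
import Literature.MathematicalPhysics.QuantumLattice.StabilityTorusGeometryProofs
import HarnessLib

/-!
# The local decomposition at one site with its LTQO bounds (MZ13 Lemmas 3–4, quantitative)

Top-down layer (seat B) of the formalisation of the Michalakis–Zwolak stability theorem
(hubbard.S19, `Literature.MathematicalPhysics.QuantumLattice.michalakis_zwolak`). For a
frustration-free projector interaction `Φ` with Local-TQO (`HasLTQO Φ Δ`, `Δ ≥ 0`) on the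
decorated torus `(ℤ/Lℤ)^d × κ`, all of whose local ground-state projections `P_{b_u(r)}` are
non-zero, and for a quasi-local perturbation term centred at the Bravais site `u`,
`X_u = Σ_{q ≤ R} X_u(q)` with `X_u(q)` Hermitian, supported in `cellBall u q`,
`‖X_u(q)‖ ≤ J f(q)` and `[X_u, P₀] = 0` (the output format of MZ13 Lemmas 1–2 / Proposition 1,
step 1), this file constructs (`exists_site_decomposition`)

`X_u = Σ_{j ≤ L} W_u(j) + Δ_u + e_u · 1`

with `e_u = Σ_q c(X_u(q))` real, `Δ_u = P₀ X̃_u P₀` (`X̃_u = X_u − e_u`) and pieces `W_u(j)` that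
are Hermitian, annihilated by `P_{b_u(j)}` on both sides (hence by `P₀`), together with the
bounds

* **Lemma 3**: `‖Δ_u‖ ≤ 2J Σ_q f(q) g_L(q)`, `g_L(q) = Δ((L−1)/2 − q)` if `2q < L` and `1` otherwise
  (MZ13 arXiv:1109.1588 p. 12: "`‖Δ_u‖ ≤ J (Σ_{r ≤ L*} f₁(r) Δ₀(L − r) + 2 Σ_{r > L*} f₁(r))`";
  here `L* ≈ L/2` is forced by the non-wrapping side condition of `HasLTQO`, and the factor `2`
  accounts for the global-versus-local constant, `HasLTQO.norm_conj_sub_smul_self_le`);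
* **Lemma 4** (telescoping variant, `StabilityLocalDecompositionProofs`): `‖W_u(0)‖ ≤ 2J F`,
  `W_u(j+1) = 0` for `2j ≥ L`, and for `2j < L`
  `‖W_u(j+1)‖ ≤ 2‖Δ_u‖ + 8J Σ_{q > j/2} f(q) + 4J F √(2 Δ(j − j/2))`, `F = Σ_q f(q)`
  (MZ13 p. 13, displays (bound1), (bound:decay1): the tail beyond `ℓ = j/2`, the LTQO comparison
  `‖O P_{b_u(j)}‖ ≈ ‖O P₀‖` of Corollary 2, and `‖O P₀‖ ≤ ‖Δ_u‖ + tail`).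

No definitions, no named facts (theorems only; the pieces are exhibited existentially).
-/

noncomputable section

open Matrix Finset Module
open scoped InnerProductSpace ComplexOrder Matrix.Norms.L2Operator

namespace Literature.MathematicalPhysics.QuantumLattice

open Literature.Probability.LatticeModels

/-! ### Recentred terms `X − c(X)·1` -/

section Recentre

variable {Λ : Type*} [Fintype Λ] [DecidableEq Λ] {q : ℕ}

/-- The recentred term `X − c_P(X)·1` is Hermitian for Hermitian `X`, `P`. [folklore] -/
theorem isHermitian_sub_ltqoConst_smul_one {P X : Op Λ q} (hP : P.IsHermitian)
    (hX : X.IsHermitian) : (X - ltqoConst P X • (1 : Op Λ q)).IsHermitian := by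
  refine hX.sub ?_
  rw [IsHermitian, conjTranspose_smul, conjTranspose_one, star_ltqoConst hP hX]

/-- The recentred term is supported wherever `X` is. [folklore] -/
theorem isSupportedOn_sub_smul_one {X : Op Λ q} {B : Finset Λ} (hX : IsSupportedOn X B) (c : ℂ) :
    IsSupportedOn (X - c • (1 : Op Λ q)) B := by
  have h : X - c • (1 : Op Λ q) = X + (-c) • (1 : Op Λ q) := by rw [neg_smul, sub_eq_add_neg]
  rw [h]
  exact hX.add ((IsSupportedOn.one B).smul (-c))

/-- Sandwiching the recentred term: `P (X − c·1) P = P X P − c P`. [folklore] -/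
theorem sandwich_sub_smul_one {P X : Op Λ q} (hP2 : P * P = P) (c : ℂ) :
    P * (X - c • (1 : Op Λ q)) * P = P * X * P - c • P := by
  rw [Matrix.mul_sub, Matrix.sub_mul, Matrix.mul_smul, Matrix.mul_one, Matrix.smul_mul, hP2]

/-- Norm of a sum of recentred terms: `‖Σ_{q ∈ s} (X q − c(X q)·1)‖ ≤ 2J Σ_{q ∈ s} f q` when
`‖X q‖ ≤ J f q`. [folklore] -/
theorem norm_sum_sub_ltqoConst_le {P : Op Λ q} (hP : P.IsHermitian) (hP2 : P * P = P)
    {X : ℕ → Op Λ q} (hX : ∀ i, (X i).IsHermitian) {J : ℝ} {f : ℕ → ℝ}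
    (hXn : ∀ i, ‖X i‖ ≤ J * f i) (s : Finset ℕ) :
    ‖∑ i ∈ s, (X i - ltqoConst P (X i) • (1 : Op Λ q))‖ ≤ 2 * J * ∑ i ∈ s, f i := by
  calc ‖∑ i ∈ s, (X i - ltqoConst P (X i) • (1 : Op Λ q))‖
      ≤ ∑ i ∈ s, ‖X i - ltqoConst P (X i) • (1 : Op Λ q)‖ := norm_sum_le _ _
    _ ≤ ∑ i ∈ s, 2 * (J * f i) := sum_le_sum fun i _ =>
        (norm_sub_ltqoConst_smul_one_le hP hP2 (hX i)).trans (by linarith [hXn i])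
    _ = 2 * J * ∑ i ∈ s, f i := by rw [mul_sum]; refine sum_congr rfl fun i _ => ?_; ring

end Recentre

/-! ### The decomposition at one site -/

section Site

variable {d L : ℕ} [NeZero L] {κ : Type*} [Fintype κ] [DecidableEq κ] {q : ℕ}

/-- **The local decomposition of a `P₀`-commuting quasi-local term with its LTQO bounds
(MZ13 Lemmas 3 and 4).** See the module docstring. Hypotheses: `Φ` has LTQO with a non-negative
rate `Δ`; every local ground-state projection of a ball is non-zero (Local-Gap in a non-empty
configuration space); `X q`, `q ≤ R`, are Hermitian, supported in `cellBall u q`, of norm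
`≤ J f q` (`J, f ≥ 0`), and their sum commutes with `P₀ = P_univ`. Conclusion: pieces `W j`
(`j ≤ L`), `D` and a real `e` with `Σ_q X q = Σ_{j ≤ L} W j + D + e·1`, every `W j` Hermitian
and annihilated by `P_{cellBall u j}` (both sides) and by `P₀`, `D = P₀ D P₀` Hermitian with
`H₀ D = 0`, and the norm bounds of Lemma 3 (`D`) and Lemma 4 (`W`).
[cite: MichalakisZwolakCMP2013, §5 Lemmas 3–4 and Prop. 1 (arXiv:1109.1588 pp. 12–13)] -/
theorem exists_site_decomposition {Φ : Interaction (TorusSite d L × κ) q} {Δ : ℕ → ℝ}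
    (hltqo : HasLTQO Φ Δ) (hΔ0 : ∀ ℓ, 0 ≤ Δ ℓ)
    (hP0 : ∀ (x : TorusSite d L) (r : ℕ),
      localGroundProj Φ (cellBall x r : Finset (TorusSite d L × κ)) ≠ 0)
    (u : TorusSite d L) (R : ℕ) (X : ℕ → Op (TorusSite d L × κ) q)
    (hXs : ∀ i, IsSupportedOn (X i) (cellBall u i)) (hXh : ∀ i, (X i).IsHermitian)
    (hc : Commute (∑ i ∈ range (R + 1), X i) (localGroundProj Φ univ))
    {J : ℝ} (hJ : 0 ≤ J) {f : ℕ → ℝ} (hf : ∀ i, 0 ≤ f i) (hXn : ∀ i, ‖X i‖ ≤ J * f i) :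
    ∃ (W : ℕ → Op (TorusSite d L × κ) q) (D : Op (TorusSite d L × κ) q) (e : ℝ),
      (∑ i ∈ range (R + 1), X i) = (∑ j ∈ range (L + 1), W j) + D + (e : ℂ) • 1 ∧
      (∀ j, (W j).IsHermitian) ∧
      (∀ j, W j * localGroundProj Φ (cellBall u j) = 0 ∧
        localGroundProj Φ (cellBall u j) * W j = 0) ∧
      (∀ j, W j * localGroundProj Φ univ = 0) ∧
      D.IsHermitian ∧ localGroundProj Φ univ * D * localGroundProj Φ univ = D ∧
      localHamiltonian Φ univ * D = 0 ∧
      ‖D‖ ≤ 2 * J * ∑ i ∈ range (R + 1),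
        f i * (if 2 * i < L then Δ ((L - 1) / 2 - i) else 1) ∧
      ‖W 0‖ ≤ 2 * J * ∑ i ∈ range (R + 1), f i ∧
      (∀ j, L ≤ 2 * j → W (j + 1) = 0) ∧
      (∀ j, 2 * j < L → ‖W (j + 1)‖ ≤
        2 * ‖D‖ + 8 * J * (∑ i ∈ (range (R + 1)).filter (fun i => j / 2 < i), f i) +
          4 * J * (∑ i ∈ range (R + 1), f i) * Real.sqrt (2 * Δ (j - j / 2))) := by
  classical
  -- notation
  set P₀ : Op (TorusSite d L × κ) q := localGroundProj Φ univ with hP₀def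
  set P : ℕ → Op (TorusSite d L × κ) q := fun j => localGroundProj Φ (cellBall u j) with hPdef
  set c : ℕ → ℂ := fun i => ltqoConst P₀ (X i) with hcdef
  set Xt : Op (TorusSite d L × κ) q := ∑ i ∈ range (R + 1), (X i - c i • (1 : Op _ q))
    with hXtdef
  set S : ℕ → Op (TorusSite d L × κ) q := fun j => (1 - P j) * Xt * (1 - P j) with hSdef
  set W : ℕ → Op (TorusSite d L × κ) q := fun j => if j = 0 then S 0 else S j - S (j - 1)
    with hWdef
  set F : ℝ := ∑ i ∈ range (R + 1), f i with hFdef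
  -- projections
  have hP₀h : P₀.IsHermitian := localGroundProj_isHermitian Φ _
  have hP₀2 : P₀ * P₀ = P₀ := (localGroundProj_idempotent Φ _).eq
  have hPh : ∀ j, (P j).IsHermitian := fun j => localGroundProj_isHermitian Φ _
  have hP2 : ∀ j, P j * P j = P j := fun j => (localGroundProj_idempotent Φ _).eq
  have hnest : ∀ j, P (j + 1) * P j = P (j + 1) := fun j =>
    localGroundProj_mul_of_subset_holds Φ (cellBall_mono u (Nat.le_succ j))
  have hPuniv : ∀ j, L ≤ 2 * j → P j = P₀ := fun j hj => by
    simp only [hPdef, hP₀def, cellBall_eq_univ_of_le_two_mul u hj]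
  have hPL : P L = P₀ := hPuniv L (by omega)
  have hP0ne : ∀ j, P j ≠ 0 := fun j => hP0 u j
  have hP₀ne : P₀ ≠ 0 := by rw [← hPL]; exact hP0ne L
  have hballP₀ : ∀ j, P j * P₀ = P₀ := fun j =>
    localGroundProj_mul_of_superset Φ (subset_univ _)
  -- the recentred sum
  have hcreal : ∀ i, star (c i) = c i := fun i => star_ltqoConst hP₀h (hXh i)
  have hXth : Xt.IsHermitian := by
    rw [hXtdef, IsHermitian, conjTranspose_sum]
    exact sum_congr rfl fun i _ => (isHermitian_sub_ltqoConst_smul_one hP₀h (hXh i)).eq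
  have hXt_eq : Xt = (∑ i ∈ range (R + 1), X i) - (∑ i ∈ range (R + 1), c i) • (1 : Op _ q) := by
    rw [hXtdef, sum_sub_distrib, sum_smul]
  have hcXt : Commute Xt P₀ := by
    rw [hXt_eq]
    exact hc.sub_left ((Commute.one_left P₀).smul_left _)
  have hnormXt : ∀ s : Finset ℕ, ‖∑ i ∈ s, (X i - c i • (1 : Op _ q))‖ ≤ 2 * J * ∑ i ∈ s, f i :=
    fun s => norm_sum_sub_ltqoConst_le hP₀h hP₀2 hXh hXn s
  have hF0 : 0 ≤ F := sum_nonneg fun i _ => hf i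
  -- the real number `e`
  set e : ℝ := (∑ i ∈ range (R + 1), c i).re with hedef
  have he : ((e : ℂ) : ℂ) = ∑ i ∈ range (R + 1), c i := by
    refine (Complex.conj_eq_iff_re.mp ?_)
    rw [map_sum]
    exact sum_congr rfl fun i _ => hcreal i
  -- pieces
  have hW0 : W 0 = S 0 := by simp [hWdef]
  have hWsucc : ∀ j, W (j + 1) = S (j + 1) - S j := fun j => by
    simp [hWdef]
  have hsumW : ∑ j ∈ range (L + 1), W j = S L := by
    rw [Finset.sum_range_succ', hW0, add_comm]
    simp only [hWsucc]
    exact add_sum_range_sub_eq S L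
  refine ⟨W, P₀ * Xt * P₀, e, ?_, ?_, ?_, ?_, ?_, ?_, ?_, ?_, ?_, ?_, ?_⟩
  -- (1) the identity
  · rw [hsumW, hSdef]
    dsimp only
    rw [hPL, ← eq_sandwich_add_sandwich_of_commute hP₀2 hcXt, he, hXt_eq, sub_add_cancel]
  -- (2) hermiticity of the pieces
  · intro j
    have hS : ∀ k, (S k).IsHermitian := fun k => by
      rw [hSdef]
      dsimp only
      have h1 : ((1 : Op _ q) - P k).IsHermitian := isHermitian_one_sub (hPh k)
      rw [IsHermitian, conjTranspose_mul, conjTranspose_mul, h1.eq, hXth.eq, Matrix.mul_assoc]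
    rcases j with _ | j
    · rw [hW0]; exact hS 0
    · rw [hWsucc]; exact (hS (j + 1)).sub (hS j)
  -- (3) annihilation by the local projection
  · intro j
    rcases j with _ | j
    · rw [hW0, hSdef]
      exact ⟨sandwich_mul_proj_eq_zero (hP2 0), proj_mul_sandwich_eq_zero (hP2 0)⟩
    · rw [hWsucc, hSdef]
      exact ⟨piece_mul_proj_eq_zero (hPh j) (hPh (j + 1)) (hP2 (j + 1)) (hnest j),
        proj_mul_piece_eq_zero (hP2 (j + 1)) (hnest j)⟩
  -- (4) annihilation by `P₀`
  · intro j
    have h3 : W j * P j = 0 := by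
      rcases j with _ | j
      · rw [hW0, hSdef]; exact sandwich_mul_proj_eq_zero (hP2 0)
      · rw [hWsucc, hSdef]
        exact piece_mul_proj_eq_zero (hPh j) (hPh (j + 1)) (hP2 (j + 1)) (hnest j)
    rw [← hballP₀ j, ← Matrix.mul_assoc, h3, Matrix.zero_mul]
  -- (5) `D` Hermitian
  · rw [IsHermitian, conjTranspose_mul, conjTranspose_mul, hP₀h.eq, hXth.eq, Matrix.mul_assoc]
  -- (6) `D = P₀ D P₀`
  · rw [← Matrix.mul_assoc, ← Matrix.mul_assoc, hP₀2, Matrix.mul_assoc, hP₀2]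
  -- (7) `H₀ D = 0`
  · rw [← Matrix.mul_assoc, ← Matrix.mul_assoc, hP₀def, localHamiltonian_mul_localGroundProj,
      Matrix.zero_mul, Matrix.zero_mul]
  -- (8) Lemma 3: the bound on `D`
  · rw [hXtdef, Finset.mul_sum, Finset.sum_mul]
    refine (norm_sum_le _ _).trans ?_
    rw [mul_sum]
    refine sum_le_sum fun i _ => ?_
    rw [sandwich_sub_smul_one hP₀2]
    have hi := hXn i
    have hfi := hf i
    by_cases h2 : 2 * i < L
    · rw [if_pos h2]
      have hlt := hltqo.norm_conj_sub_smul_self_le (hXs i) (hXh i)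
        (two_mul_add_half_pred_sub_lt h2) (subset_univ _) hP₀ne
      refine hlt.trans ?_
      have hΔ := hΔ0 ((L - 1) / 2 - i)
      nlinarith [mul_le_mul_of_nonneg_right hi hΔ]
    · rw [if_neg h2, mul_one]
      calc ‖P₀ * X i * P₀ - c i • P₀‖ = ‖P₀ * (X i - c i • (1 : Op _ q)) * P₀‖ := by
            rw [sandwich_sub_smul_one hP₀2]
        _ ≤ ‖P₀ * (X i - c i • (1 : Op _ q))‖ * ‖P₀‖ := l2_opNorm_mul _ _
        _ ≤ ‖P₀‖ * ‖X i - c i • (1 : Op _ q)‖ * ‖P₀‖ := by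
            gcongr; exact l2_opNorm_mul _ _
        _ ≤ 1 * ‖X i - c i • (1 : Op _ q)‖ * 1 := by
            gcongr
            · exact norm_le_one_of_isHermitian_of_isIdempotentElem hP₀h hP₀2
            · exact norm_le_one_of_isHermitian_of_isIdempotentElem hP₀h hP₀2
        _ = ‖X i - c i • (1 : Op _ q)‖ := by ring
        _ ≤ 2 * ‖X i‖ := norm_sub_ltqoConst_smul_one_le hP₀h hP₀2 (hXh i)
        _ ≤ 2 * J * f i := by linarith
  -- (9) `‖W 0‖ ≤ 2 J F`
  · rw [hW0, hSdef]
    dsimp only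
    calc ‖(1 - P 0) * Xt * (1 - P 0)‖ ≤ ‖(1 - P 0) * Xt‖ * ‖(1 : Op _ q) - P 0‖ := l2_opNorm_mul _ _
      _ ≤ ‖(1 : Op _ q) - P 0‖ * ‖Xt‖ * ‖(1 : Op _ q) - P 0‖ := by
          gcongr; exact l2_opNorm_mul _ _
      _ ≤ 1 * ‖Xt‖ * 1 := by
          gcongr
          · exact norm_one_sub_le_one (hPh 0) (hP2 0)
          · exact norm_one_sub_le_one (hPh 0) (hP2 0)
      _ = ‖Xt‖ := by ring
      _ ≤ 2 * J * F := hnormXt _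
  -- (10) `W (j+1) = 0` in the wrapping range
  · intro j hj
    have h1 : P j = P₀ := hPuniv j hj
    have h2 : P (j + 1) = P₀ := hPuniv (j + 1) (by omega)
    rw [hWsucc, hSdef]
    dsimp only
    rw [h1, h2, sub_self]
  -- (11) Lemma 4: the bound on `W (j+1)` in the LTQO range
  · intro j hj
    set ℓ : ℕ := j / 2 with hℓdef
    set O : Op (TorusSite d L × κ) q :=
      ∑ i ∈ (range (R + 1)).filter (fun i => i ≤ ℓ), (X i - c i • (1 : Op _ q)) with hOdef
    set T : Op (TorusSite d L × κ) q :=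
      ∑ i ∈ (range (R + 1)).filter (fun i => ¬ i ≤ ℓ), (X i - c i • (1 : Op _ q)) with hTdef
    have hOT : Xt = O + T := by rw [hXtdef, hOdef, hTdef, sum_filter_add_sum_filter_not]
    have hXtO : Xt - O = T := by rw [hOT, add_sub_cancel_left]
    have hOh : O.IsHermitian := by
      rw [hOdef, IsHermitian, conjTranspose_sum]
      exact sum_congr rfl fun i _ => (isHermitian_sub_ltqoConst_smul_one hP₀h (hXh i)).eq
    have hOs : IsSupportedOn O (cellBall u ℓ) := by
      rw [hOdef]
      refine IsSupportedOn.sum _ fun i hi => ?_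
      have hiℓ : i ≤ ℓ := (mem_filter.mp hi).2
      exact isSupportedOn_sub_smul_one (IsSupportedOn.mono_holds (hXs i) (cellBall_mono u hiℓ)) _
    have hOn : ‖O‖ ≤ 2 * J * F := by
      refine (hnormXt _).trans ?_
      have : ∑ i ∈ (range (R + 1)).filter (fun i => i ≤ ℓ), f i ≤ F :=
        sum_le_sum_of_subset_of_nonneg (filter_subset _ _) fun i _ _ => hf i
      nlinarith
    have hTn : ‖T‖ ≤ 2 * J * ∑ i ∈ (range (R + 1)).filter (fun i => j / 2 < i), f i := by
      have hT' : T = ∑ i ∈ (range (R + 1)).filter (fun i => j / 2 < i),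
          (X i - c i • (1 : Op _ q)) := by
        rw [hTdef]
        refine sum_congr ?_ fun _ _ => rfl
        ext i
        simp only [mem_filter, not_le, hℓdef]
      rw [hT']
      exact hnormXt _
    -- the LTQO comparison of `‖O P_j‖` and `‖O P₀‖`
    have hℓj : ℓ + (j - ℓ) = j := by omega
    have hcmp : |‖O * P j‖ - ‖O * P₀‖| ≤ Real.sqrt (2 * (‖O‖ ^ 2 * Δ (j - ℓ))) := by
      have hL2 : 2 * (ℓ + (j - ℓ)) < L := by rw [hℓj]; exact hj
      have h := hltqo.abs_norm_mul_localGroundProj_sub_le hOs hL2 (B₁ := cellBall u j)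
        (B₂ := univ) (by rw [hℓj]) (subset_univ _) (hP0ne j) hP₀ne
      exact h
    have hsqrt : Real.sqrt (2 * (‖O‖ ^ 2 * Δ (j - ℓ))) = ‖O‖ * Real.sqrt (2 * Δ (j - ℓ)) := by
      rw [show 2 * (‖O‖ ^ 2 * Δ (j - ℓ)) = ‖O‖ ^ 2 * (2 * Δ (j - ℓ)) by ring,
        Real.sqrt_mul (sq_nonneg _), Real.sqrt_sq (norm_nonneg _)]
    have hOPj : ‖O * P j‖ ≤ ‖O * P₀‖ + ‖O‖ * Real.sqrt (2 * Δ (j - ℓ)) := by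
      rw [← hsqrt]
      have := (abs_le.mp hcmp).2
      linarith
    have hOP₀ : ‖O * P₀‖ ≤ ‖P₀ * Xt * P₀‖ + ‖Xt - O‖ := norm_mul_proj_le_of_commute hP₀h hP₀2 hcXt
    have hpiece := norm_piece_le (Y := Xt) hXth (hPh j) (hP2 j) (hPh (j + 1)) (hP2 (j + 1))
    have hlayer := norm_layer_mul_le (Y := Xt) hOh (hPh j) (hP2 j) (hPh (j + 1)) (hP2 (j + 1))
      (hnest j)
    rw [hWsucc, hSdef]
    dsimp only
    refine hpiece.trans ?_
    rw [hXtO] at hOP₀ hlayer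
    have hsq0 : 0 ≤ Real.sqrt (2 * Δ (j - ℓ)) := Real.sqrt_nonneg _
    have hkey : ‖(P j - P (j + 1)) * Xt‖ ≤
        ‖P₀ * Xt * P₀‖ + 2 * ‖T‖ + ‖O‖ * Real.sqrt (2 * Δ (j - ℓ)) := by linarith
    calc 2 * ‖(P j - P (j + 1)) * Xt‖
        ≤ 2 * (‖P₀ * Xt * P₀‖ + 2 * ‖T‖ + ‖O‖ * Real.sqrt (2 * Δ (j - ℓ))) := by linarith
      _ ≤ 2 * (‖P₀ * Xt * P₀‖ + 2 * (2 * J * ∑ i ∈ (range (R + 1)).filter (fun i => j / 2 < i), f i)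
            + (2 * J * F) * Real.sqrt (2 * Δ (j - ℓ))) := by
          gcongr
      _ = 2 * ‖P₀ * Xt * P₀‖ + 8 * J * (∑ i ∈ (range (R + 1)).filter (fun i => j / 2 < i), f i) +
            4 * J * F * Real.sqrt (2 * Δ (j - j / 2)) := by rw [hℓdef]; ring

end Site

end Literature.MathematicalPhysics.QuantumLattice
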